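import Literature.Analysis.FluidPDE.CaloricRemainderStokesSystem
import Literature.Analysis.FluidPDE.PlateauWindowKernels
import Literature.Analysis.FluidPDE.NSSliceTimePairing
import Literature.Analysis.FluidPDE.ClassicalSobolevUniqueness
import Literature.Analysis.FluidPDE.MollifiedField
import Literature.Analysis.FluidPDE.LocalLerayCylinderSliceNorms
import HarnessLib

/-!
# The energy identity of the remainder `w = u − E` tested against a spatial cut-off

Analysis/FluidPDE support file (theorems only) on the discharge path of
`Literature.Analysis.FluidPDE.AlbrittonBarker2019_liouville_weakL3_backward` (Barker–Seregin–Šverák,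
arXiv:1603.03211, Lemma 3.4: the global energy method for `w = u − E`). From the local energy
equality of the Stokes system solved by `w` (`remainder_local_energy_equality`) tested with the
product `φ(t, x) = χ(t) ψ(x)` of a time test function `χ ∈ C_c^∞((δ, S))` and a space test function
`ψ ∈ C_c^∞(ℝ³)` we obtain the distributional identity in time
`∫ (χ' Y + χ Z) = 0`, `Y(t) = ∫ ψ|w(t)|²`,
`Z(t) = ∫ (Δψ |w|² + 2p w·∇ψ + 2⟪−(u·∇)u, w⟫ψ) − 2∫ |∇w|²ψ`
(`setIntegral_deriv_mul_energy_add_eq_zero`), whence, by du Bois-Reymond's lemma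
(`exists_ae_eq_const_add_primitive`) and the continuity of `Y`, the two-time identity
`Y(t₂) − Y(t₁) = ∫_{t₁}^{t₂} Z` for all `0 < t₁ ≤ t₂ < S` (`remainder_tested_energy_identity`) and,
for `ψ ≥ 0`, after dropping the dissipation and integrating the transport term by parts
(`div u = 0`), the two-time inequality
`∫ψ|w(t₂)|² ≤ ∫ψ|w(t₁)|² + ∫_{t₁}^{t₂} (∫ (Δψ + u·∇ψ)|w|² + 2∫ p w·∇ψ − 2∫ ψ⟪(u·∇)E, w⟫)`
(`remainder_tested_energy_inequality`).

## References

* T. Barker, G. Seregin, V. Šverák, arXiv:1603.03211, Lemma 3.4 (proof). [`BarkerSeregin2016`]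
* L. Caffarelli, R. Kohn, L. Nirenberg, CPAM 35 (1982), §2 (2.5). [`CaffarelliKohnNirenberg1982`]
-/

noncomputable section

open MeasureTheory Set Function Filter Metric TopologicalSpace InnerProductSpace
open _root_.Topology
open scoped NNReal ENNReal Laplacian RealInnerProductSpace ContDiff

namespace Literature.Analysis.FluidPDE

open UnboundedOperators FunctionSpaces

variable {S : ℝ} {u E' : ℝ → EuclideanSpace ℝ (Fin 3) → EuclideanSpace ℝ (Fin 3)}
  {p : ℝ → EuclideanSpace ℝ (Fin 3) → ℝ} {ψ : EuclideanSpace ℝ (Fin 3) → ℝ}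

/-! ### Topological helpers -/

/-- A function continuous on the open slab `(0, S) × ℝ³` and vanishing off a compact subset of it
is continuous on the whole space–time. [folklore] -/
theorem continuous_of_continuousOn_slab_of_eq_zero_off {G : Type*} [TopologicalSpace G] [Zero G]
    {F : ℝ × EuclideanSpace ℝ (Fin 3) → G}
    (hF : ContinuousOn F (Ioo 0 S ×ˢ (univ : Set (EuclideanSpace ℝ (Fin 3)))))
    {K : Set (ℝ × EuclideanSpace ℝ (Fin 3))} (hK : IsCompact K)
    (hKQ : K ⊆ Ioo 0 S ×ˢ (univ : Set (EuclideanSpace ℝ (Fin 3)))) (h0 : ∀ z ∉ K, F z = 0) :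
    Continuous F := by
  refine continuous_iff_continuousAt.2 fun z => ?_
  by_cases hz : z ∈ Ioo 0 S ×ˢ (univ : Set (EuclideanSpace ℝ (Fin 3)))
  · exact hF.continuousAt ((isOpen_Ioo.prod isOpen_univ).mem_nhds hz)
  · have hzK : z ∉ K := fun h => hz (hKQ h)
    have hev : F =ᶠ[𝓝 z] fun _ => 0 := by
      filter_upwards [hK.isClosed.isOpen_compl.mem_nhds hzK] with y hy
      exact h0 y hy
    exact (continuousAt_const.congr hev.symm)

/-- The window bounds of the data on `[δ, S) × ℝ³`: `u`, `∇u`, `E`, `∇E` are bounded there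
(`δ > 0`; KNSS for `∇u`). [folklore] -/
theorem exists_window_bounds (hS : 0 < S)
    (hcont : ContinuousOn (uncurry u) (Icc 0 S ×ˢ univ)) {K : ℝ}
    (hK : ∀ t ∈ Icc 0 S, ∀ x, ‖u t x‖ ≤ K) (hdiv : ∀ t ∈ Icc 0 S, IsWeaklyDivFree (u t))
    (hmild : ∀ s t : ℝ, 0 ≤ s → s < t → t ≤ S → ∀ x,
      u t x = heatExtension (u s) (t - s) x - oseenDuhamel 1 s u u t x)
    (hEB : ∀ δ : ℝ, 0 < δ → ∃ B : ℝ, ∀ t ∈ Ico δ S, ∀ x, ‖E' t x‖ ≤ B ∧ ‖fderiv ℝ (E' t) x‖ ≤ B)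
    {δ : ℝ} (hδ : 0 < δ) :
    ∃ B : ℝ, 0 ≤ B ∧ ∀ t ∈ Ioo δ S, ∀ x, ‖u t x‖ ≤ B ∧ ‖fderiv ℝ (u t) x‖ ≤ B ∧
      ‖E' t x‖ ≤ B ∧ ‖fderiv ℝ (E' t) x‖ ≤ B ∧ ‖u t x - E' t x‖ ≤ B ∧
      ‖fderiv ℝ (u t) x - fderiv ℝ (E' t) x‖ ≤ B := by
  obtain ⟨-, -, hC1, -⟩ := smooth_of_oseenForward hS hcont hK hdiv hmild
  obtain ⟨C₁, hC₁⟩ := hC1 δ hδ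
  obtain ⟨B₁, hB₁⟩ := hEB δ hδ
  have hK0 : 0 ≤ K := (norm_nonneg _).trans (hK 0 ⟨le_rfl, hS.le⟩ 0)
  refine ⟨|K| + |C₁| + |B₁| + |B₁|, by positivity, fun t ht x => ?_⟩
  have h1 : ‖u t x‖ ≤ K := hK t ⟨(hδ.trans ht.1).le, ht.2.le⟩ x
  have h2 := hC₁ t ht x
  obtain ⟨h3, h4⟩ := hB₁ t ⟨ht.1.le, ht.2⟩ x
  have hK' : K ≤ |K| := le_abs_self K
  have hC' : C₁ ≤ |C₁| := le_abs_self C₁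
  have hB' : B₁ ≤ |B₁| := le_abs_self B₁
  have h0 : 0 ≤ |K| ∧ 0 ≤ |C₁| ∧ 0 ≤ |B₁| := ⟨abs_nonneg _, abs_nonneg _, abs_nonneg _⟩
  refine ⟨by linarith, by linarith, by linarith, by linarith,
    (norm_sub_le _ _).trans (by linarith), (norm_sub_le _ _).trans (by linarith)⟩

/-- A continuous function vanishing off a compact set is bounded. [folklore] -/
theorem exists_bound_of_continuous_of_eq_zero_off {X G : Type*} [TopologicalSpace X]
    [NormedAddCommGroup G] {K : Set X} (hK : IsCompact K) {g : X → G} (hg : Continuous g)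
    (h0 : ∀ x ∉ K, g x = 0) : ∃ M : ℝ, 0 ≤ M ∧ ∀ x, ‖g x‖ ≤ M := by
  obtain ⟨C, hC⟩ := hK.exists_bound_of_continuousOn hg.continuousOn
  refine ⟨max C 0, le_max_right _ _, fun x => ?_⟩
  by_cases hx : x ∈ K
  · exact (hC x hx).trans (le_max_left _ _)
  · rw [h0 x hx, norm_zero]; exact le_max_right _ _

/-! ### The distributional identity in time -/

/-- **Integrability on the strip `(δ, S) × ℝ³`** of the slab integrands of the tested energy
balance of `w = u − E` (`ψ|w|²`, `Δψ|w|²`, `p w·∇ψ`, `⟪−(u·∇)u, w⟫ψ`, `|∇w|²ψ`, `(u·∇ψ)|w|²`,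
`ψ⟪(u·∇)E, w⟫`): all but the pressure term are bounded, measurable and supported in
`(δ, S) × supp ψ`; the pressure term is the product of `p ∈ L²` and a bounded compactly
supported factor. [folklore] -/
theorem integrableOn_strip_tested_terms (hS : 0 < S)
    (hcont : ContinuousOn (uncurry u) (Icc 0 S ×ˢ univ)) {K : ℝ}
    (hK : ∀ t ∈ Icc 0 S, ∀ x, ‖u t x‖ ≤ K) (hdiv : ∀ t ∈ Icc 0 S, IsWeaklyDivFree (u t))
    (hmild : ∀ s t : ℝ, 0 ≤ s → s < t → t ≤ S → ∀ x,
      u t x = heatExtension (u s) (t - s) x - oseenDuhamel 1 s u u t x)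
    (hEc : ContinuousOn (fun q : ℝ × EuclideanSpace ℝ (Fin 3) => E' q.1 q.2) (Ioi 0 ×ˢ univ))
    (hEDc : ContinuousOn (fun q : ℝ × EuclideanSpace ℝ (Fin 3) => fderiv ℝ (E' q.1) q.2) (Ioi 0 ×ˢ univ))
    (hEB : ∀ δ : ℝ, 0 < δ → ∃ B : ℝ, ∀ t ∈ Ico δ S, ∀ x, ‖E' t x‖ ≤ B ∧ ‖fderiv ℝ (E' t) x‖ ≤ B)
    (hp2 : MemLp (uncurry p) 2 (volume.restrict (Ioo 0 S ×ˢ (univ : Set (EuclideanSpace ℝ (Fin 3))))))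
    (hψ : ContDiff ℝ (⊤ : ℕ∞) ψ) (hψc : HasCompactSupport ψ) {δ : ℝ} (hδ : 0 < δ) :
    IntegrableOn (fun z : ℝ × EuclideanSpace ℝ (Fin 3) => ψ z.2 * ‖u z.1 z.2 - E' z.1 z.2‖ ^ 2)
      (Ioo δ S ×ˢ univ) volume ∧
    IntegrableOn (fun z : ℝ × EuclideanSpace ℝ (Fin 3) => (Δ ψ) z.2 * ‖u z.1 z.2 - E' z.1 z.2‖ ^ 2)
      (Ioo δ S ×ˢ univ) volume ∧
    IntegrableOn (fun z : ℝ × EuclideanSpace ℝ (Fin 3) =>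
      p z.1 z.2 * ⟪u z.1 z.2 - E' z.1 z.2, gradient ψ z.2⟫) (Ioo δ S ×ˢ univ) volume ∧
    IntegrableOn (fun z : ℝ × EuclideanSpace ℝ (Fin 3) =>
      ⟪-(fderiv ℝ (u z.1) z.2 (u z.1 z.2)), u z.1 z.2 - E' z.1 z.2⟫ * ψ z.2) (Ioo δ S ×ˢ univ) volume ∧
    IntegrableOn (fun z : ℝ × EuclideanSpace ℝ (Fin 3) =>
      frobeniusNormSq (fderiv ℝ (u z.1) z.2 - fderiv ℝ (E' z.1) z.2) * ψ z.2) (Ioo δ S ×ˢ univ) volume ∧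
    IntegrableOn (fun z : ℝ × EuclideanSpace ℝ (Fin 3) =>
      ⟪u z.1 z.2, gradient ψ z.2⟫ * ‖u z.1 z.2 - E' z.1 z.2‖ ^ 2) (Ioo δ S ×ˢ univ) volume ∧
    IntegrableOn (fun z : ℝ × EuclideanSpace ℝ (Fin 3) =>
      ψ z.2 * ⟪fderiv ℝ (E' z.1) z.2 (u z.1 z.2), u z.1 z.2 - E' z.1 z.2⟫) (Ioo δ S ×ˢ univ) volume := by
  haveI : ENNReal.HolderTriple 2 2 1 := ENNReal.HolderConjugate.instTwoTwo
  obtain ⟨B, hB0, hB⟩ := exists_window_bounds hS hcont hK hdiv hmild hEB hδ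
  have hDu := continuousOn_fderiv_of_oseenForward hS hcont hK hdiv hmild
  -- the space cut-off
  set Kψ : Set (EuclideanSpace ℝ (Fin 3)) := tsupport ψ with hKψ
  have hKψc : IsCompact Kψ := hψc
  have hψ0 : ∀ x ∉ Kψ, ψ x = 0 := fun x hx => image_eq_zero_of_notMem_tsupport hx
  have hgψ0 : ∀ x ∉ Kψ, gradient ψ x = 0 := fun x hx => gradient_eq_zero_of_notMem_tsupport hx
  have hΔψ0 : ∀ x ∉ Kψ, (Δ ψ) x = 0 := fun x hx => laplacian_eq_zero_of_notMem_tsupport hx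
  have cψ : Continuous ψ := hψ.continuous
  have cgψ : Continuous (gradient ψ) := by
    change Continuous fun x => (InnerProductSpace.toDual ℝ (EuclideanSpace ℝ (Fin 3))).symm (fderiv ℝ ψ x)
    exact (InnerProductSpace.toDual ℝ (EuclideanSpace ℝ (Fin 3))).symm.continuous.comp
      (hψ.continuous_fderiv (by simp))
  have cΔψ : Continuous (Δ ψ) := continuous_laplacian (contDiff_infty.1 hψ 2)
  obtain ⟨Mψ, hMψ0, hMψ⟩ := exists_bound_of_continuous_of_eq_zero_off hKψc cψ hψ0
  obtain ⟨Mg, hMg0, hMg⟩ := exists_bound_of_continuous_of_eq_zero_off hKψc cgψ hgψ0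
  obtain ⟨MΔ, hMΔ0, hMΔ⟩ := exists_bound_of_continuous_of_eq_zero_off hKψc cΔψ hΔψ0
  have hMψ' : ∀ x, |ψ x| ≤ Mψ := fun x => by simpa [Real.norm_eq_abs] using hMψ x
  have hMΔ' : ∀ x, |(Δ ψ) x| ≤ MΔ := fun x => by simpa [Real.norm_eq_abs] using hMΔ x
  -- continuity on the open slab
  have hQI : Ioo 0 S ×ˢ (univ : Set (EuclideanSpace ℝ (Fin 3))) ⊆ Ioi 0 ×ˢ univ :=
    prod_mono (fun t ht => ht.1) Subset.rfl
  have hTQ : Ioo δ S ×ˢ (univ : Set (EuclideanSpace ℝ (Fin 3))) ⊆ Ioo 0 S ×ˢ univ :=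
    prod_mono (Ioo_subset_Ioo_left hδ.le) Subset.rfl
  have hSm : MeasurableSet (Ioo 0 S ×ˢ (univ : Set (EuclideanSpace ℝ (Fin 3)))) :=
    measurableSet_Ioo.prod MeasurableSet.univ
  have hTm : MeasurableSet (Ioo δ S ×ˢ (univ : Set (EuclideanSpace ℝ (Fin 3)))) :=
    measurableSet_Ioo.prod MeasurableSet.univ
  have cu : ContinuousOn (fun z : ℝ × EuclideanSpace ℝ (Fin 3) => u z.1 z.2) (Ioo 0 S ×ˢ univ) :=
    hcont.mono (prod_mono Ioo_subset_Icc_self Subset.rfl)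
  have cw : ContinuousOn (fun z : ℝ × EuclideanSpace ℝ (Fin 3) => u z.1 z.2 - E' z.1 z.2) (Ioo 0 S ×ˢ univ) :=
    cu.sub (hEc.mono hQI)
  have cG : ContinuousOn (fun z : ℝ × EuclideanSpace ℝ (Fin 3) => fderiv ℝ (u z.1) z.2 - fderiv ℝ (E' z.1) z.2)
      (Ioo 0 S ×ˢ univ) := hDu.sub (hEDc.mono hQI)
  have cf : ContinuousOn (fun z : ℝ × EuclideanSpace ℝ (Fin 3) => -(fderiv ℝ (u z.1) z.2 (u z.1 z.2)))
      (Ioo 0 S ×ˢ univ) := (hDu.clm_apply cu).neg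
  have cψ2 : Continuous fun z : ℝ × EuclideanSpace ℝ (Fin 3) => ψ z.2 := cψ.comp continuous_snd
  have cgψ2 : Continuous fun z : ℝ × EuclideanSpace ℝ (Fin 3) => gradient ψ z.2 := cgψ.comp continuous_snd
  have cΔψ2 : Continuous fun z : ℝ × EuclideanSpace ℝ (Fin 3) => (Δ ψ) z.2 := cΔψ.comp continuous_snd
  -- the slab integrands
  set FY : ℝ × EuclideanSpace ℝ (Fin 3) → ℝ := fun z => ψ z.2 * ‖u z.1 z.2 - E' z.1 z.2‖ ^ 2 with hFY
  set FA : ℝ × EuclideanSpace ℝ (Fin 3) → ℝ := fun z => (Δ ψ) z.2 * ‖u z.1 z.2 - E' z.1 z.2‖ ^ 2 with hFA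
  set g : ℝ × EuclideanSpace ℝ (Fin 3) → ℝ := fun z => ⟪u z.1 z.2 - E' z.1 z.2, gradient ψ z.2⟫ with hg
  set FP : ℝ × EuclideanSpace ℝ (Fin 3) → ℝ := fun z => p z.1 z.2 * g z with hFP
  set FC : ℝ × EuclideanSpace ℝ (Fin 3) → ℝ := fun z =>
    ⟪-(fderiv ℝ (u z.1) z.2 (u z.1 z.2)), u z.1 z.2 - E' z.1 z.2⟫ * ψ z.2 with hFC
  set FD : ℝ × EuclideanSpace ℝ (Fin 3) → ℝ := fun z =>
    frobeniusNormSq (fderiv ℝ (u z.1) z.2 - fderiv ℝ (E' z.1) z.2) * ψ z.2 with hFD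
  -- integrability on the strip `(δ, S) × ℝ³`
  have hvolT : volume (Ioo δ S ×ˢ Kψ) < (⊤ : ℝ≥0∞) := by
    rw [Measure.volume_eq_prod, Measure.prod_prod]
    exact ENNReal.mul_lt_top measure_Ioo_lt_top hKψc.measure_lt_top
  have hstrip : ∀ F : ℝ × EuclideanSpace ℝ (Fin 3) → ℝ, ContinuousOn F (Ioo 0 S ×ˢ univ) →
      (∀ z : ℝ × EuclideanSpace ℝ (Fin 3), z.2 ∉ Kψ → F z = 0) →
      ∀ C : ℝ, (∀ z ∈ Ioo δ S ×ˢ (univ : Set (EuclideanSpace ℝ (Fin 3))), ‖F z‖ ≤ C) →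
      IntegrableOn F (Ioo δ S ×ˢ (univ : Set (EuclideanSpace ℝ (Fin 3)))) volume := by
    intro F hF h0 C hC
    have hKm : MeasurableSet (Ioo δ S ×ˢ Kψ) := measurableSet_Ioo.prod hKψc.measurableSet
    have hmeas : AEStronglyMeasurable F (volume.restrict (Ioo δ S ×ˢ Kψ)) :=
      (hF.mono ((prod_mono Subset.rfl (subset_univ _)).trans hTQ)).aestronglyMeasurable hKm
    haveI : IsFiniteMeasure (volume.restrict (Ioo δ S ×ˢ Kψ)) := isFiniteMeasure_restrict.2 hvolT.ne
    have hI : IntegrableOn F (Ioo δ S ×ˢ Kψ) volume := by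
      refine ⟨hmeas, HasFiniteIntegral.of_bounded (C := C) ?_⟩
      filter_upwards [ae_restrict_mem hKm] with z hz
      exact hC z ⟨hz.1, mem_univ _⟩
    exact hI.of_forall_sdiff_eq_zero hTm fun z hz => h0 z fun h2 => hz.2 ⟨hz.1.1, h2⟩
  have hFYi : IntegrableOn FY (Ioo δ S ×ˢ univ) volume := by
    refine hstrip FY (cψ2.continuousOn.mul (cw.norm.pow 2))
      (fun z hz => by simp only [hFY, hψ0 _ hz, zero_mul])
      (Mψ * B ^ 2) fun z hz => ?_
    obtain ⟨-, -, -, -, hw, -⟩ := hB z.1 hz.1 z.2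
    rw [hFY, norm_mul, norm_pow, norm_norm, Real.norm_eq_abs]
    exact mul_le_mul (hMψ' _) (pow_le_pow_left₀ (norm_nonneg _) hw 2) (by positivity) hMψ0
  have hFAi : IntegrableOn FA (Ioo δ S ×ˢ univ) volume := by
    refine hstrip FA (cΔψ2.continuousOn.mul (cw.norm.pow 2))
      (fun z hz => by simp only [hFA, hΔψ0 _ hz, zero_mul])
      (MΔ * B ^ 2) fun z hz => ?_
    obtain ⟨-, -, -, -, hw, -⟩ := hB z.1 hz.1 z.2
    rw [hFA, norm_mul, norm_pow, norm_norm, Real.norm_eq_abs]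
    exact mul_le_mul (hMΔ' _) (pow_le_pow_left₀ (norm_nonneg _) hw 2) (by positivity) hMΔ0
  have hgi : IntegrableOn g (Ioo δ S ×ˢ univ) volume := by
    refine hstrip g (cw.inner cgψ2.continuousOn)
      (fun z hz => by simp only [hg, hgψ0 _ hz, inner_zero_right]) (B * Mg)
      fun z hz => ?_
    obtain ⟨-, -, -, -, hw, -⟩ := hB z.1 hz.1 z.2
    exact (norm_inner_le_norm _ _).trans (mul_le_mul hw (hMg _) (norm_nonneg _) hB0)
  have hFCi : IntegrableOn FC (Ioo δ S ×ˢ univ) volume := by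
    refine hstrip FC ((cf.inner cw).mul cψ2.continuousOn)
      (fun z hz => by simp only [hFC, hψ0 _ hz, mul_zero])
      (B * B * B * Mψ) fun z hz => ?_
    obtain ⟨hu, hDu', -, -, hw, -⟩ := hB z.1 hz.1 z.2
    rw [hFC, norm_mul, Real.norm_eq_abs (ψ z.2)]
    refine mul_le_mul ?_ (hMψ' _) (abs_nonneg _) (by positivity)
    refine (norm_inner_le_norm _ _).trans ?_
    rw [norm_neg]
    exact mul_le_mul ((ContinuousLinearMap.le_opNorm _ _).trans (mul_le_mul hDu' hu (norm_nonneg _) hB0))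
      hw (norm_nonneg _) (by positivity)
  have hFDi : IntegrableOn FD (Ioo δ S ×ˢ univ) volume := by
    have cfrob : ContinuousOn (fun z : ℝ × EuclideanSpace ℝ (Fin 3) =>
        frobeniusNormSq (fderiv ℝ (u z.1) z.2 - fderiv ℝ (E' z.1) z.2)) (Ioo 0 S ×ˢ univ) := by
      unfold frobeniusNormSq
      exact continuousOn_finsetSum _ fun i _ => ((cG.clm_apply continuousOn_const).norm).pow 2
    refine hstrip FD (cfrob.mul cψ2.continuousOn)
      (fun z hz => by simp only [hFD, hψ0 _ hz, mul_zero])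
      (3 * B ^ 2 * Mψ) fun z hz => ?_
    obtain ⟨-, -, -, -, -, hGz⟩ := hB z.1 hz.1 z.2
    have h0 := frobeniusNormSq_nonneg (fderiv ℝ (u z.1) z.2 - fderiv ℝ (E' z.1) z.2)
    have h3 := frobeniusNormSq_le_three_mul_norm_sq (fderiv ℝ (u z.1) z.2 - fderiv ℝ (E' z.1) z.2)
    rw [hFD, norm_mul, Real.norm_of_nonneg h0, Real.norm_eq_abs]
    refine mul_le_mul (h3.trans ?_) (hMψ' _) (abs_nonneg _) (by positivity)
    exact mul_le_mul_of_nonneg_left (pow_le_pow_left₀ (norm_nonneg _) hGz 2) (by norm_num)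
  -- the pressure term: `p ∈ L²` of the strip times the bounded compactly supported `g ∈ L²`
  have hp2T : MemLp (uncurry p) 2 (volume.restrict (Ioo δ S ×ˢ (univ : Set (EuclideanSpace ℝ (Fin 3))))) :=
    hp2.mono_measure (Measure.restrict_mono hTQ le_rfl)
  have hg2 : MemLp g 2 (volume.restrict (Ioo δ S ×ˢ (univ : Set (EuclideanSpace ℝ (Fin 3))))) := by
    refine (memLp_two_iff_integrable_sq hgi.aestronglyMeasurable).2 ?_
    refine (hgi.norm.const_mul (B * Mg)).mono' (hgi.aestronglyMeasurable.pow 2) ?_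
    filter_upwards [ae_restrict_mem hTm] with z hz
    obtain ⟨-, -, -, -, hw, -⟩ := hB z.1 hz.1 z.2
    have hgz : |g z| ≤ B * Mg :=
      (abs_real_inner_le_norm _ _).trans (mul_le_mul hw (hMg _) (norm_nonneg _) hB0)
    rw [Real.norm_eq_abs, abs_pow, pow_two, Real.norm_eq_abs]
    exact mul_le_mul_of_nonneg_right hgz (abs_nonneg _)
  have hFPi : IntegrableOn FP (Ioo δ S ×ˢ univ) volume := by
    have h := hp2T.integrable_mul hg2
    exact h.congr (Eventually.of_forall fun z => by simp [hFP, uncurry])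
  -- the transport weight `⟪u, ∇ψ⟫|w|²` and the coupling `ψ⟪DE(u), w⟫`
  have hFTi : IntegrableOn (fun z : ℝ × EuclideanSpace ℝ (Fin 3) =>
      ⟪u z.1 z.2, gradient ψ z.2⟫ * ‖u z.1 z.2 - E' z.1 z.2‖ ^ 2) (Ioo δ S ×ˢ univ) volume := by
    refine hstrip _ ((cu.inner cgψ2.continuousOn).mul (cw.norm.pow 2))
      (fun z hz => by simp only [hgψ0 _ hz, inner_zero_right, zero_mul]) (B * Mg * B ^ 2) fun z hz => ?_
    obtain ⟨hu, -, -, -, hw, -⟩ := hB z.1 hz.1 z.2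
    rw [norm_mul, norm_pow, norm_norm, Real.norm_eq_abs]
    exact mul_le_mul ((abs_real_inner_le_norm _ _).trans (mul_le_mul hu (hMg _) (norm_nonneg _) hB0))
      (pow_le_pow_left₀ (norm_nonneg _) hw 2) (by positivity) (by positivity)
  have hFEi : IntegrableOn (fun z : ℝ × EuclideanSpace ℝ (Fin 3) =>
      ψ z.2 * ⟪fderiv ℝ (E' z.1) z.2 (u z.1 z.2), u z.1 z.2 - E' z.1 z.2⟫) (Ioo δ S ×ˢ univ) volume := by
    refine hstrip _ (cψ2.continuousOn.mul (((hEDc.mono hQI).clm_apply cu).inner cw))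
      (fun z hz => by simp only [hψ0 _ hz, zero_mul]) (Mψ * (B * B * B)) fun z hz => ?_
    obtain ⟨hu, -, -, hDE, hw, -⟩ := hB z.1 hz.1 z.2
    rw [norm_mul, Real.norm_eq_abs]
    refine mul_le_mul (hMψ' _) ?_ (norm_nonneg _) hMψ0
    refine (norm_inner_le_norm _ _).trans ?_
    exact mul_le_mul ((ContinuousLinearMap.le_opNorm _ _).trans (mul_le_mul hDE hu (norm_nonneg _) hB0))
      hw (norm_nonneg _) (by positivity)
  exact ⟨hFYi, hFAi, hFPi, hFCi, hFDi, hFTi, hFEi⟩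


/-- **The local energy equality tested with `χ(t)ψ(x)`.** In the setting of
`remainder_local_energy_equality`, for `δ > 0`, a time test function `χ ∈ C_c^∞((δ, S))` and a
space test function `ψ ∈ C_c^∞(ℝ³)`:
`∫_{(δ,S)} (χ'(t) Y(t) + χ(t) Z(t)) dt = 0` with `Y(t) = ∫ ψ |w(t)|²` and
`Z(t) = ∫ (Δψ |w|² + 2 p w·∇ψ + 2⟪−(u·∇)u, w⟫ ψ) dx − 2 ∫ |∇w|² ψ dx`, `w = u − E`; moreover
`Y` and `Z` are integrable on `(δ, S)`. [cite: BarkerSeregin2016, Lemma 3.4 (proof); CaffarelliKohnNirenberg1982, §2 (2.5)] -/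
theorem setIntegral_deriv_mul_energy_add_eq_zero (hS : 0 < S)
    (hcont : ContinuousOn (uncurry u) (Icc 0 S ×ˢ univ)) {K : ℝ}
    (hK : ∀ t ∈ Icc 0 S, ∀ x, ‖u t x‖ ≤ K) (hdiv : ∀ t ∈ Icc 0 S, IsWeaklyDivFree (u t))
    (hmild : ∀ s t : ℝ, 0 ≤ s → s < t → t ≤ S → ∀ x,
      u t x = heatExtension (u s) (t - s) x - oseenDuhamel 1 s u u t x)
    (hEc : ContinuousOn (fun q : ℝ × EuclideanSpace ℝ (Fin 3) => E' q.1 q.2) (Ioi 0 ×ˢ univ))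
    (hEDc : ContinuousOn (fun q : ℝ × EuclideanSpace ℝ (Fin 3) => fderiv ℝ (E' q.1) q.2) (Ioi 0 ×ˢ univ))
    (hEΔc : ContinuousOn (fun q : ℝ × EuclideanSpace ℝ (Fin 3) => (Δ (E' q.1)) q.2) (Ioi 0 ×ˢ univ))
    (hEsm : ∀ t, 0 < t → ContDiff ℝ 2 (E' t)) (hEdiv : ∀ t, 0 < t → VectorCalculus.IsDivFree (E' t))
    (hEt : ∀ t, 0 < t → ∀ x, HasDerivAt (fun s => E' s x) ((Δ (E' t)) x) t)
    (hEB : ∀ δ : ℝ, 0 < δ → ∃ B : ℝ, ∀ t ∈ Ico δ S, ∀ x, ‖E' t x‖ ≤ B ∧ ‖fderiv ℝ (E' t) x‖ ≤ B)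
    (hNS : IsDistributionalNSSolutionOn (slab (EuclideanSpace ℝ (Fin 3)) (Ioo 0 S) isOpen_Ioo) 1 0 u p)
    (hp2 : MemLp (uncurry p) 2 (volume.restrict (Ioo 0 S ×ˢ (univ : Set (EuclideanSpace ℝ (Fin 3))))))
    (hψ : ContDiff ℝ (⊤ : ℕ∞) ψ) (hψc : HasCompactSupport ψ) {δ : ℝ} (hδ : 0 < δ) :
    IntegrableOn (fun t => ∫ x, ψ x * ‖u t x - E' t x‖ ^ 2) (Ioo δ S) volume ∧
    IntegrableOn (fun t =>
      (∫ x, ((Δ ψ) x * ‖u t x - E' t x‖ ^ 2 + 2 * (p t x * ⟪u t x - E' t x, gradient ψ x⟫) +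
        2 * (⟪-(fderiv ℝ (u t) x (u t x)), u t x - E' t x⟫ * ψ x))) -
      2 * ∫ x, frobeniusNormSq (fderiv ℝ (u t) x - fderiv ℝ (E' t) x) * ψ x) (Ioo δ S) volume ∧
    ∀ χ : ℝ → ℝ, ContDiff ℝ (⊤ : ℕ∞) χ → HasCompactSupport χ → tsupport χ ⊆ Ioo δ S →
      ∫ t in Ioo δ S, (deriv χ t * (∫ x, ψ x * ‖u t x - E' t x‖ ^ 2) + χ t *
        ((∫ x, ((Δ ψ) x * ‖u t x - E' t x‖ ^ 2 + 2 * (p t x * ⟪u t x - E' t x, gradient ψ x⟫) +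
          2 * (⟪-(fderiv ℝ (u t) x (u t x)), u t x - E' t x⟫ * ψ x))) -
        2 * ∫ x, frobeniusNormSq (fderiv ℝ (u t) x - fderiv ℝ (E' t) x) * ψ x)) = 0 := by
  obtain ⟨hFYi, hFAi, hFPi, hFCi, hFDi, -, -⟩ := integrableOn_strip_tested_terms hS hcont hK hdiv hmild
    hEc hEDc hEB hp2 hψ hψc hδ
  have hSm : MeasurableSet (Ioo 0 S ×ˢ (univ : Set (EuclideanSpace ℝ (Fin 3)))) :=
    measurableSet_Ioo.prod MeasurableSet.univ
  set FY : ℝ × EuclideanSpace ℝ (Fin 3) → ℝ := fun z => ψ z.2 * ‖u z.1 z.2 - E' z.1 z.2‖ ^ 2 with hFY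
  set FA : ℝ × EuclideanSpace ℝ (Fin 3) → ℝ := fun z => (Δ ψ) z.2 * ‖u z.1 z.2 - E' z.1 z.2‖ ^ 2 with hFA
  set FP : ℝ × EuclideanSpace ℝ (Fin 3) → ℝ := fun z =>
    p z.1 z.2 * ⟪u z.1 z.2 - E' z.1 z.2, gradient ψ z.2⟫ with hFP
  set FC : ℝ × EuclideanSpace ℝ (Fin 3) → ℝ := fun z =>
    ⟪-(fderiv ℝ (u z.1) z.2 (u z.1 z.2)), u z.1 z.2 - E' z.1 z.2⟫ * ψ z.2 with hFC
  set FD : ℝ × EuclideanSpace ℝ (Fin 3) → ℝ := fun z =>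
    frobeniusNormSq (fderiv ℝ (u z.1) z.2 - fderiv ℝ (E' z.1) z.2) * ψ z.2 with hFD
  set FR : ℝ × EuclideanSpace ℝ (Fin 3) → ℝ := fun z => FA z + 2 * FP z + 2 * FC z with hFR
  have hFRi : IntegrableOn FR (Ioo δ S ×ˢ univ) volume :=
    (hFAi.add (hFPi.const_mul 2)).add (hFCi.const_mul 2)
  -- marginals in time
  have hmarg : ∀ F : ℝ × EuclideanSpace ℝ (Fin 3) → ℝ,
      IntegrableOn F (Ioo δ S ×ˢ (univ : Set (EuclideanSpace ℝ (Fin 3)))) volume →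
      IntegrableOn (fun t => ∫ x, F (t, x)) (Ioo δ S) volume := by
    intro F hF
    rw [IntegrableOn, volume_restrict_slab_eq_prod] at hF
    exact hF.integral_prod_left
  have hYi : IntegrableOn (fun t => ∫ x, ψ x * ‖u t x - E' t x‖ ^ 2) (Ioo δ S) volume := hmarg FY hFYi
  have hRi : IntegrableOn (fun t => ∫ x, ((Δ ψ) x * ‖u t x - E' t x‖ ^ 2 +
      2 * (p t x * ⟪u t x - E' t x, gradient ψ x⟫) +
      2 * (⟪-(fderiv ℝ (u t) x (u t x)), u t x - E' t x⟫ * ψ x))) (Ioo δ S) volume := hmarg FR hFRi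
  have hDi : IntegrableOn (fun t => ∫ x, frobeniusNormSq (fderiv ℝ (u t) x - fderiv ℝ (E' t) x) * ψ x)
      (Ioo δ S) volume := hmarg FD hFDi
  refine ⟨hYi, hRi.sub (hDi.const_mul 2), fun χ hχ hχc hχδ => ?_⟩
  -- ### the identity for a time test function `χ`
  have hχ0 : ∀ t ∉ tsupport χ, χ t = 0 := fun t ht => image_eq_zero_of_notMem_tsupport ht
  have hdχ0 : ∀ t ∉ tsupport χ, deriv χ t = 0 := fun t ht => by
    by_contra h
    exact ht (support_deriv_subset (mem_support.2 h))
  have cχ : Continuous χ := hχ.continuous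
  have cdχ : Continuous (deriv χ) := hχ.continuous_deriv (by simp)
  obtain ⟨Mχ, hMχ⟩ := cχ.bounded_above_of_compact_support hχc
  obtain ⟨Mdχ, hMdχ⟩ := cdχ.bounded_above_of_compact_support hχc.deriv
  rcases (tsupport χ).eq_empty_or_nonempty with hempty | hne
  · have hz : ∀ t, χ t = 0 := fun t => hχ0 t (by simp [hempty])
    have hdz : ∀ t, deriv χ t = 0 := fun t => hdχ0 t (by simp [hempty])
    simp [hz, hdz]
  obtain ⟨a, ha⟩ := hχc.isCompact.exists_isLeast hne
  obtain ⟨b, hb⟩ := hχc.isCompact.exists_isGreatest hne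
  have hsuppχ : support χ ⊆ Icc a b := fun t ht =>
    ⟨ha.2 (subset_tsupport _ ht), hb.2 (subset_tsupport _ ht)⟩
  have h0a : 0 < a := hδ.trans (hχδ ha.1).1
  have hbS : b < S := (hχδ hb.1).2
  have hφ : IsSpaceTimeTestOn (slab (EuclideanSpace ℝ (Fin 3)) (Ioo 0 S) isOpen_Ioo)
      (fun t x => χ t * ψ x) :=
    isSpaceTimeTestOn_mul_of_support_subset hχ hsuppχ h0a hbS hψ hψc
  have key := remainder_local_energy_equality hS hcont hK hdiv hmild hEc hEDc hEΔc hEsm hEdiv hEt hNS hp2 hφ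
  have e1 : ∀ t x, timeDeriv (fun s y => χ s * ψ y) t x = deriv χ t * ψ x := fun t x =>
    timeDeriv_mul_const_space ψ (hχ.differentiable (by simp)) t x
  have e2 : ∀ t x, (Δ (fun y => χ t * ψ y)) x = χ t * (Δ ψ) x := fun t x =>
    laplacian_mul_const_time χ (contDiff_infty.1 hψ 2) t x
  have e3 : ∀ t x, gradient (fun y => χ t * ψ y) x = χ t • gradient ψ x := fun t x =>
    gradient_mul_const_time χ t ((hψ.differentiable (by simp)) x)
  simp only [e1, e2, e3, inner_smul_right] at key
  -- the time-weighted integrands and their integrability on the slab `(0, S) × ℝ³`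
  have hext : ∀ F : ℝ × EuclideanSpace ℝ (Fin 3) → ℝ,
      IntegrableOn F (Ioo δ S ×ˢ (univ : Set (EuclideanSpace ℝ (Fin 3)))) volume →
      ∀ (w : ℝ → ℝ), Continuous w → (∀ t ∉ tsupport χ, w t = 0) → (∃ C, ∀ t, ‖w t‖ ≤ C) →
      IntegrableOn (fun z : ℝ × EuclideanSpace ℝ (Fin 3) => w z.1 * F z)
        (Ioo 0 S ×ˢ (univ : Set (EuclideanSpace ℝ (Fin 3)))) volume := by
    intro F hF w hw hw0 hwC
    have h1 : IntegrableOn (fun z : ℝ × EuclideanSpace ℝ (Fin 3) => w z.1 * F z)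
        (Ioo δ S ×ˢ (univ : Set (EuclideanSpace ℝ (Fin 3)))) volume :=
      by
        obtain ⟨C, hC⟩ := hwC
        exact hF.bdd_mul (c := C) (hw.comp continuous_fst).aestronglyMeasurable
          (Eventually.of_forall fun z => hC z.1)
    refine h1.of_forall_sdiff_eq_zero hSm fun z hz => ?_
    have hz1 : z.1 ∉ tsupport χ := fun h => hz.2 ⟨hχδ h, mem_univ _⟩
    rw [hw0 z.1 hz1, zero_mul]
  have hPi := hext FY hFYi (deriv χ) cdχ hdχ0 ⟨Mdχ, hMdχ⟩
  have hQi := hext FR hFRi χ cχ hχ0 ⟨Mχ, hMχ⟩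
  have hDDi := hext FD hFDi χ cχ hχ0 ⟨Mχ, hMχ⟩
  -- the tested local energy equality reads `2 ∫ χ FD = ∫ χ' FY + ∫ χ FR`
  have keyL : ∫ z in Ioo 0 S ×ˢ (univ : Set (EuclideanSpace ℝ (Fin 3))),
      frobeniusNormSq (fderiv ℝ (u z.1) z.2 - fderiv ℝ (E' z.1) z.2) * (χ z.1 * ψ z.2) =
      ∫ z in Ioo 0 S ×ˢ (univ : Set (EuclideanSpace ℝ (Fin 3))), χ z.1 * FD z :=
    setIntegral_congr_fun hSm fun z _ => by simp only [hFD]; ring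
  have keyR : ∫ z in Ioo 0 S ×ˢ (univ : Set (EuclideanSpace ℝ (Fin 3))),
      (‖u z.1 z.2 - E' z.1 z.2‖ ^ 2 * (deriv χ z.1 * ψ z.2 + χ z.1 * (Δ ψ) z.2) +
        2 * (p z.1 z.2 * (χ z.1 * ⟪u z.1 z.2 - E' z.1 z.2, gradient ψ z.2⟫)) +
        2 * (⟪-(fderiv ℝ (u z.1) z.2 (u z.1 z.2)), u z.1 z.2 - E' z.1 z.2⟫ * (χ z.1 * ψ z.2))) =
      (∫ z in Ioo 0 S ×ˢ (univ : Set (EuclideanSpace ℝ (Fin 3))), deriv χ z.1 * FY z) +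
        ∫ z in Ioo 0 S ×ˢ (univ : Set (EuclideanSpace ℝ (Fin 3))), χ z.1 * FR z := by
    rw [← integral_add hPi hQi]
    refine setIntegral_congr_fun hSm fun z _ => ?_
    simp only [hFY, hFR, hFA, hFP, hFC]
    ring
  rw [keyL, keyR] at key
  -- Fubini for the three slab integrals
  rw [LocalEnergyConcat.setIntegral_slab_eq_integral_integral hDDi,
    LocalEnergyConcat.setIntegral_slab_eq_integral_integral hPi,
    LocalEnergyConcat.setIntegral_slab_eq_integral_integral hQi] at key
  simp only [integral_const_mul] at key
  -- time marginals on `(0, S)`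
  have hmarg0 : ∀ F : ℝ × EuclideanSpace ℝ (Fin 3) → ℝ,
      IntegrableOn F (Ioo 0 S ×ˢ (univ : Set (EuclideanSpace ℝ (Fin 3)))) volume →
      IntegrableOn (fun t => ∫ x, F (t, x)) (Ioo 0 S) volume := by
    intro F hF
    rw [IntegrableOn, volume_restrict_slab_eq_prod] at hF
    exact hF.integral_prod_left
  have m1 := hmarg0 _ hPi
  have m2 := hmarg0 _ hQi
  have m3 := hmarg0 _ hDDi
  simp only [integral_const_mul] at m1 m2 m3
  -- pass from `(δ, S)` to `(0, S)`: the integrand vanishes off `tsupport χ ⊆ (δ, S)`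
  have hvan : ∀ t ∉ Ioo δ S, deriv χ t * (∫ x, ψ x * ‖u t x - E' t x‖ ^ 2) + χ t *
      ((∫ x, ((Δ ψ) x * ‖u t x - E' t x‖ ^ 2 + 2 * (p t x * ⟪u t x - E' t x, gradient ψ x⟫) +
        2 * (⟪-(fderiv ℝ (u t) x (u t x)), u t x - E' t x⟫ * ψ x))) -
      2 * ∫ x, frobeniusNormSq (fderiv ℝ (u t) x - fderiv ℝ (E' t) x) * ψ x) = 0 := by
    intro t ht
    have ht' : t ∉ tsupport χ := fun h => ht (hχδ h)
    rw [hχ0 t ht', hdχ0 t ht', zero_mul, zero_mul, add_zero]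
  rw [setIntegral_eq_integral_of_forall_compl_eq_zero fun t ht => hvan t ht,
    ← setIntegral_eq_integral_of_forall_compl_eq_zero fun t (ht : t ∉ Ioo 0 S) =>
      hvan t fun h => ht ⟨hδ.trans h.1, h.2⟩]
  have hsplit : ∫ t in Ioo 0 S, (deriv χ t * (∫ x, ψ x * ‖u t x - E' t x‖ ^ 2) + χ t *
      ((∫ x, ((Δ ψ) x * ‖u t x - E' t x‖ ^ 2 + 2 * (p t x * ⟪u t x - E' t x, gradient ψ x⟫) +
        2 * (⟪-(fderiv ℝ (u t) x (u t x)), u t x - E' t x⟫ * ψ x))) -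
      2 * ∫ x, frobeniusNormSq (fderiv ℝ (u t) x - fderiv ℝ (E' t) x) * ψ x)) =
      (∫ t in Ioo 0 S, deriv χ t * ∫ x, FY (t, x)) + (∫ t in Ioo 0 S, χ t * ∫ x, FR (t, x)) -
        2 * ∫ t in Ioo 0 S, χ t * ∫ x, FD (t, x) := by
    have m12 : IntegrableOn (fun t => deriv χ t * (∫ x, FY (t, x)) + χ t * ∫ x, FR (t, x)) (Ioo 0 S) volume :=
      m1.add m2
    have m3' : IntegrableOn (fun t => 2 * (χ t * ∫ x, FD (t, x))) (Ioo 0 S) volume := m3.const_mul 2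
    rw [← integral_add m1 m2, ← integral_const_mul, ← integral_sub m12 m3']
    refine setIntegral_congr_fun measurableSet_Ioo fun t _ => ?_
    simp only [hFY, hFR, hFA, hFP, hFC, hFD]
    ring
  rw [hsplit]
  linarith

/-! ### Continuity of the tested energy -/

/-- **`t ↦ ∫ ψ |w(t)|²` is continuous on `(0, S)`** (`w = u − E` jointly continuous on the open
slab, `ψ` compactly supported; dominated convergence). [folklore] -/
theorem continuousOn_integral_mul_norm_sq_remainder (hS : 0 < S)
    (hcont : ContinuousOn (uncurry u) (Icc 0 S ×ˢ univ)) {K : ℝ}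
    (hK : ∀ t ∈ Icc 0 S, ∀ x, ‖u t x‖ ≤ K) (hdiv : ∀ t ∈ Icc 0 S, IsWeaklyDivFree (u t))
    (hmild : ∀ s t : ℝ, 0 ≤ s → s < t → t ≤ S → ∀ x,
      u t x = heatExtension (u s) (t - s) x - oseenDuhamel 1 s u u t x)
    (hEc : ContinuousOn (fun q : ℝ × EuclideanSpace ℝ (Fin 3) => E' q.1 q.2) (Ioi 0 ×ˢ univ))
    (hEB : ∀ δ : ℝ, 0 < δ → ∃ B : ℝ, ∀ t ∈ Ico δ S, ∀ x, ‖E' t x‖ ≤ B ∧ ‖fderiv ℝ (E' t) x‖ ≤ B)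
    (hψ : ContDiff ℝ (⊤ : ℕ∞) ψ) (hψc : HasCompactSupport ψ) :
    ContinuousOn (fun t => ∫ x, ψ x * ‖u t x - E' t x‖ ^ 2) (Ioo 0 S) := by
  have hQI : Ioo 0 S ×ˢ (univ : Set (EuclideanSpace ℝ (Fin 3))) ⊆ Ioi 0 ×ˢ univ :=
    prod_mono (fun t ht => ht.1) Subset.rfl
  have cu : ContinuousOn (fun z : ℝ × EuclideanSpace ℝ (Fin 3) => u z.1 z.2) (Ioo 0 S ×ˢ univ) :=
    hcont.mono (prod_mono Ioo_subset_Icc_self Subset.rfl)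
  have cw : ContinuousOn (fun z : ℝ × EuclideanSpace ℝ (Fin 3) => u z.1 z.2 - E' z.1 z.2) (Ioo 0 S ×ˢ univ) :=
    cu.sub (hEc.mono hQI)
  have cψ : Continuous ψ := hψ.continuous
  set Kψ : Set (EuclideanSpace ℝ (Fin 3)) := tsupport ψ with hKψ
  have hKψc : IsCompact Kψ := hψc
  have hψ0 : ∀ x ∉ Kψ, ψ x = 0 := fun x hx => image_eq_zero_of_notMem_tsupport hx
  obtain ⟨Mψ, hMψ0, hMψ⟩ := exists_bound_of_continuous_of_eq_zero_off hKψc cψ hψ0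
  refine fun t₀ ht₀ => ContinuousAt.continuousWithinAt ?_
  have hδ : 0 < t₀ / 2 := by linarith [ht₀.1]
  obtain ⟨B, hB0, hB⟩ := exists_window_bounds hS hcont hK hdiv hmild hEB hδ
  have ht₀' : t₀ ∈ Ioo (t₀ / 2) S := ⟨by linarith [ht₀.1], ht₀.2⟩
  have hU : Ioo (t₀ / 2) S ∈ 𝓝 t₀ := isOpen_Ioo.mem_nhds ht₀'
  have hslice : ∀ t ∈ Ioo 0 S, Continuous fun x => u t x - E' t x := fun t ht =>
    (cw.comp_continuous (f := fun x : EuclideanSpace ℝ (Fin 3) => (t, x)) (by fun_prop)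
      fun x => ⟨ht, mem_univ _⟩ :)
  refine continuousAt_of_dominated (bound := Kψ.indicator fun _ => Mψ * B ^ 2) ?_ ?_ ?_ ?_
  · filter_upwards [hU] with t ht
    exact (cψ.mul ((hslice t ⟨hδ.trans ht.1, ht.2⟩).norm.pow 2)).aestronglyMeasurable
  · filter_upwards [hU] with t ht
    refine Eventually.of_forall fun x => ?_
    by_cases hx : x ∈ Kψ
    · obtain ⟨-, -, -, -, hw, -⟩ := hB t ht x
      rw [indicator_of_mem hx, norm_mul, norm_pow, norm_norm]
      exact mul_le_mul (hMψ x) (pow_le_pow_left₀ (norm_nonneg _) hw 2) (by positivity) hMψ0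
    · rw [indicator_of_notMem hx, hψ0 x hx, zero_mul, norm_zero]
  · exact (integrableOn_const (C := Mψ * B ^ 2) (hs := hKψc.measure_lt_top.ne)).integrable_indicator
      hKψc.measurableSet
  · refine Eventually.of_forall fun x => ?_
    have hx : ContinuousAt (fun t => u t x - E' t x) t₀ :=
      (cw.continuousAt ((isOpen_Ioo.prod isOpen_univ).mem_nhds ⟨ht₀, mem_univ _⟩)).comp
        (f := fun t : ℝ => ((t, x) : ℝ × EuclideanSpace ℝ (Fin 3))) (by fun_prop)
    exact (continuousAt_const.mul (hx.norm.pow 2))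

/-! ### The two-time identity and inequality -/

/-- **Two-time energy identity for the tested remainder** (du Bois-Reymond's lemma applied to
`setIntegral_deriv_mul_energy_add_eq_zero`, and continuity of `t ↦ ∫ ψ|w(t)|²`): for
`0 < t₁ ≤ t₂ < S`,
`∫ψ|w(t₂)|² − ∫ψ|w(t₁)|² = ∫_{t₁}^{t₂} (∫(Δψ|w|² + 2p w·∇ψ + 2⟪−(u·∇)u, w⟫ψ) − 2∫|∇w|²ψ) dt`.
[cite: BarkerSeregin2016, Lemma 3.4 (proof); CaffarelliKohnNirenberg1982, §2 (2.5)] -/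
theorem remainder_tested_energy_identity (hS : 0 < S)
    (hcont : ContinuousOn (uncurry u) (Icc 0 S ×ˢ univ)) {K : ℝ}
    (hK : ∀ t ∈ Icc 0 S, ∀ x, ‖u t x‖ ≤ K) (hdiv : ∀ t ∈ Icc 0 S, IsWeaklyDivFree (u t))
    (hmild : ∀ s t : ℝ, 0 ≤ s → s < t → t ≤ S → ∀ x,
      u t x = heatExtension (u s) (t - s) x - oseenDuhamel 1 s u u t x)
    (hEc : ContinuousOn (fun q : ℝ × EuclideanSpace ℝ (Fin 3) => E' q.1 q.2) (Ioi 0 ×ˢ univ))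
    (hEDc : ContinuousOn (fun q : ℝ × EuclideanSpace ℝ (Fin 3) => fderiv ℝ (E' q.1) q.2) (Ioi 0 ×ˢ univ))
    (hEΔc : ContinuousOn (fun q : ℝ × EuclideanSpace ℝ (Fin 3) => (Δ (E' q.1)) q.2) (Ioi 0 ×ˢ univ))
    (hEsm : ∀ t, 0 < t → ContDiff ℝ 2 (E' t)) (hEdiv : ∀ t, 0 < t → VectorCalculus.IsDivFree (E' t))
    (hEt : ∀ t, 0 < t → ∀ x, HasDerivAt (fun s => E' s x) ((Δ (E' t)) x) t)
    (hEB : ∀ δ : ℝ, 0 < δ → ∃ B : ℝ, ∀ t ∈ Ico δ S, ∀ x, ‖E' t x‖ ≤ B ∧ ‖fderiv ℝ (E' t) x‖ ≤ B)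
    (hNS : IsDistributionalNSSolutionOn (slab (EuclideanSpace ℝ (Fin 3)) (Ioo 0 S) isOpen_Ioo) 1 0 u p)
    (hp2 : MemLp (uncurry p) 2 (volume.restrict (Ioo 0 S ×ˢ (univ : Set (EuclideanSpace ℝ (Fin 3))))))
    (hψ : ContDiff ℝ (⊤ : ℕ∞) ψ) (hψc : HasCompactSupport ψ)
    {t₁ t₂ : ℝ} (ht₁ : 0 < t₁) (h12 : t₁ ≤ t₂) (ht₂ : t₂ < S) :
    (∫ x, ψ x * ‖u t₂ x - E' t₂ x‖ ^ 2) - (∫ x, ψ x * ‖u t₁ x - E' t₁ x‖ ^ 2) =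
      ∫ t in Ioc t₁ t₂,
        ((∫ x, ((Δ ψ) x * ‖u t x - E' t x‖ ^ 2 + 2 * (p t x * ⟪u t x - E' t x, gradient ψ x⟫) +
          2 * (⟪-(fderiv ℝ (u t) x (u t x)), u t x - E' t x⟫ * ψ x))) -
        2 * ∫ x, frobeniusNormSq (fderiv ℝ (u t) x - fderiv ℝ (E' t) x) * ψ x) := by
  set δ : ℝ := t₁ / 2 with hδ_def
  have hδ : 0 < δ := by positivity
  have hδt₁ : δ < t₁ := by rw [hδ_def]; linarith
  obtain ⟨hYi, hZi, hid⟩ := setIntegral_deriv_mul_energy_add_eq_zero hS hcont hK hdiv hmild hEc hEDc hEΔc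
    hEsm hEdiv hEt hEB hNS hp2 hψ hψc hδ
  set Y : ℝ → ℝ := fun t => ∫ x, ψ x * ‖u t x - E' t x‖ ^ 2 with hY
  set Z : ℝ → ℝ := fun t =>
    (∫ x, ((Δ ψ) x * ‖u t x - E' t x‖ ^ 2 + 2 * (p t x * ⟪u t x - E' t x, gradient ψ x⟫) +
      2 * (⟪-(fderiv ℝ (u t) x (u t x)), u t x - E' t x⟫ * ψ x))) -
    2 * ∫ x, frobeniusNormSq (fderiv ℝ (u t) x - fderiv ℝ (E' t) x) * ψ x with hZ
  obtain ⟨c, hc⟩ := exists_ae_eq_const_add_primitive (g := Y) (f := Z) hYi hZi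
    fun χ hχ hχc hχI => hid χ hχ hχc hχI
  -- both sides are continuous on `(δ, S)`, hence equal everywhere there
  have hYc : ContinuousOn Y (Ioo δ S) :=
    (continuousOn_integral_mul_norm_sq_remainder hS hcont hK hdiv hmild hEc hEB hψ hψc).mono
      (Ioo_subset_Ioo_left hδ.le)
  have hZI : IntegrableOn Z (Icc δ S) volume :=
    (integrableOn_Icc_iff_integrableOn_Ioo (by simp) (by simp)).2 hZi
  have hVc : ContinuousOn (fun t => c + ∫ s in Ioc δ t, Z s) (Ioo δ S) :=
    (continuousOn_const.add (intervalIntegral.continuousOn_primitive hZI)).mono Ioo_subset_Icc_self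
  have heq : EqOn Y (fun t => c + ∫ s in Ioc δ t, Z s) (Ioo δ S) :=
    Measure.eqOn_open_of_ae_eq hc isOpen_Ioo hYc hVc
  have h1 : t₁ ∈ Ioo δ S := ⟨hδt₁, h12.trans_lt ht₂⟩
  have h2 : t₂ ∈ Ioo δ S := ⟨hδt₁.trans_le h12, ht₂⟩
  have e1 := heq h1
  have e2 := heq h2
  simp only at e1 e2
  change Y t₂ - Y t₁ = ∫ t in Ioc t₁ t₂, Z t
  rw [e1, e2, ← intervalIntegral.integral_of_le (hδt₁.le.trans h12),
    ← intervalIntegral.integral_of_le hδt₁.le, ← intervalIntegral.integral_of_le h12, add_sub_add_left_eq_sub,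
    intervalIntegral.integral_interval_sub_left]
  · exact (intervalIntegrable_iff_integrableOn_Ioc_of_le (hδt₁.le.trans h12)).2
      (hZI.mono_set (Ioc_subset_Icc_self.trans (Icc_subset_Icc_right ht₂.le)))
  · exact (intervalIntegrable_iff_integrableOn_Ioc_of_le hδt₁.le).2
      (hZI.mono_set (Ioc_subset_Icc_self.trans (Icc_subset_Icc_right (h12.trans ht₂.le))))

/-- **Two-time energy inequality for the tested remainder.** In the setting of
`remainder_tested_energy_identity`, for `ψ ≥ 0` and `0 < t₁ ≤ t₂ < S`: the three slice
functionals `∫ (Δψ + u·∇ψ)|w|²`, `∫ p w·∇ψ`, `∫ ψ⟪(u·∇)E, w⟫` are integrable on `(t₁, t₂]`, and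
`∫ψ|w(t₂)|² ≤ ∫ψ|w(t₁)|² + ∫_{t₁}^{t₂} (∫ (Δψ + u·∇ψ)|w|² + 2∫ p w·∇ψ − 2∫ ψ⟪(u·∇)E, w⟫) dt`
(drop the dissipation `2∫|∇w|²ψ ≥ 0`; expand `(u·∇)u = (u·∇)w + (u·∇)E` and integrate the
transport term by parts, `2∫ψ⟪(u·∇)w, w⟫ = −∫(u·∇ψ)|w|²` since `div u = 0`).
[cite: BarkerSeregin2016, Lemma 3.4 (proof)] -/
theorem remainder_tested_energy_inequality (hS : 0 < S)
    (hcont : ContinuousOn (uncurry u) (Icc 0 S ×ˢ univ)) {K : ℝ}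
    (hK : ∀ t ∈ Icc 0 S, ∀ x, ‖u t x‖ ≤ K) (hdiv : ∀ t ∈ Icc 0 S, IsWeaklyDivFree (u t))
    (hmild : ∀ s t : ℝ, 0 ≤ s → s < t → t ≤ S → ∀ x,
      u t x = heatExtension (u s) (t - s) x - oseenDuhamel 1 s u u t x)
    (hEc : ContinuousOn (fun q : ℝ × EuclideanSpace ℝ (Fin 3) => E' q.1 q.2) (Ioi 0 ×ˢ univ))
    (hEDc : ContinuousOn (fun q : ℝ × EuclideanSpace ℝ (Fin 3) => fderiv ℝ (E' q.1) q.2) (Ioi 0 ×ˢ univ))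
    (hEΔc : ContinuousOn (fun q : ℝ × EuclideanSpace ℝ (Fin 3) => (Δ (E' q.1)) q.2) (Ioi 0 ×ˢ univ))
    (hEsm : ∀ t, 0 < t → ContDiff ℝ 2 (E' t)) (hEdiv : ∀ t, 0 < t → VectorCalculus.IsDivFree (E' t))
    (hEt : ∀ t, 0 < t → ∀ x, HasDerivAt (fun s => E' s x) ((Δ (E' t)) x) t)
    (hEB : ∀ δ : ℝ, 0 < δ → ∃ B : ℝ, ∀ t ∈ Ico δ S, ∀ x, ‖E' t x‖ ≤ B ∧ ‖fderiv ℝ (E' t) x‖ ≤ B)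
    (hNS : IsDistributionalNSSolutionOn (slab (EuclideanSpace ℝ (Fin 3)) (Ioo 0 S) isOpen_Ioo) 1 0 u p)
    (hp2 : MemLp (uncurry p) 2 (volume.restrict (Ioo 0 S ×ˢ (univ : Set (EuclideanSpace ℝ (Fin 3))))))
    (hψ : ContDiff ℝ (⊤ : ℕ∞) ψ) (hψc : HasCompactSupport ψ) (hψ0 : ∀ x, 0 ≤ ψ x)
    {t₁ t₂ : ℝ} (ht₁ : 0 < t₁) (h12 : t₁ ≤ t₂) (ht₂ : t₂ < S) :
    IntegrableOn (fun t => ∫ x, ((Δ ψ) x + ⟪u t x, gradient ψ x⟫) * ‖u t x - E' t x‖ ^ 2)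
      (Ioc t₁ t₂) volume ∧
    IntegrableOn (fun t => ∫ x, p t x * ⟪u t x - E' t x, gradient ψ x⟫) (Ioc t₁ t₂) volume ∧
    IntegrableOn (fun t => ∫ x, ψ x * ⟪fderiv ℝ (E' t) x (u t x), u t x - E' t x⟫) (Ioc t₁ t₂) volume ∧
    ∫ x, ψ x * ‖u t₂ x - E' t₂ x‖ ^ 2 ≤ (∫ x, ψ x * ‖u t₁ x - E' t₁ x‖ ^ 2) +
      ∫ t in Ioc t₁ t₂, ((∫ x, ((Δ ψ) x + ⟪u t x, gradient ψ x⟫) * ‖u t x - E' t x‖ ^ 2) +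
        2 * (∫ x, p t x * ⟪u t x - E' t x, gradient ψ x⟫) -
        2 * ∫ x, ψ x * ⟪fderiv ℝ (E' t) x (u t x), u t x - E' t x⟫) := by
  set δ : ℝ := t₁ / 2 with hδ_def
  have hδ : 0 < δ := by positivity
  have hδt₁ : δ < t₁ := by rw [hδ_def]; linarith
  have hsub : Ioc t₁ t₂ ⊆ Ioo δ S := fun t ht => ⟨hδt₁.trans ht.1, ht.2.trans_lt ht₂⟩
  obtain ⟨hsm, hdf, -, -⟩ := smooth_of_oseenForward hS hcont hK hdiv hmild
  obtain ⟨-, hFAi, hFPi, hFCi, hFDi, hFTi, hFEi⟩ := integrableOn_strip_tested_terms hS hcont hK hdiv hmild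
    hEc hEDc hEB hp2 hψ hψc hδ
  obtain ⟨-, hZi, -⟩ := setIntegral_deriv_mul_energy_add_eq_zero hS hcont hK hdiv hmild hEc hEDc hEΔc
    hEsm hEdiv hEt hEB hNS hp2 hψ hψc hδ
  have hid := remainder_tested_energy_identity hS hcont hK hdiv hmild hEc hEDc hEΔc hEsm hEdiv hEt hEB
    hNS hp2 hψ hψc ht₁ h12 ht₂
  -- time marginals of the strip integrands
  have hmarg : ∀ F : ℝ × EuclideanSpace ℝ (Fin 3) → ℝ,
      IntegrableOn F (Ioo δ S ×ˢ (univ : Set (EuclideanSpace ℝ (Fin 3)))) volume →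
      IntegrableOn (fun t => ∫ x, F (t, x)) (Ioc t₁ t₂) volume ∧
        ∀ᵐ t ∂(volume.restrict (Ioc t₁ t₂)), Integrable (fun x => F (t, x)) volume := by
    intro F hF
    rw [IntegrableOn, volume_restrict_slab_eq_prod] at hF
    have h1 : IntegrableOn (fun t => ∫ x, F (t, x)) (Ioo δ S) volume := hF.integral_prod_left
    exact ⟨h1.mono_set hsub, ae_restrict_of_ae_restrict_of_subset hsub hF.prod_right_ae⟩
  obtain ⟨mA, -⟩ := hmarg _ hFAi
  obtain ⟨mP, aeP⟩ := hmarg _ hFPi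
  obtain ⟨mC, -⟩ := hmarg _ hFCi
  obtain ⟨mD, -⟩ := hmarg _ hFDi
  obtain ⟨mT, -⟩ := hmarg _ hFTi
  obtain ⟨mE, -⟩ := hmarg _ hFEi
  -- compactly supported weights
  have hψ00 : ∀ x ∉ tsupport ψ, ψ x = 0 := fun x hx => image_eq_zero_of_notMem_tsupport hx
  have cψ : Continuous ψ := hψ.continuous
  have cgψ : Continuous (gradient ψ) := by
    change Continuous fun x => (InnerProductSpace.toDual ℝ (EuclideanSpace ℝ (Fin 3))).symm (fderiv ℝ ψ x)
    exact (InnerProductSpace.toDual ℝ (EuclideanSpace ℝ (Fin 3))).symm.continuous.comp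
      (hψ.continuous_fderiv (by simp))
  have cΔψ : Continuous (Δ ψ) := continuous_laplacian (contDiff_infty.1 hψ 2)
  have hgψc : HasCompactSupport (gradient ψ) :=
    HasCompactSupport.intro hψc fun x hx => gradient_eq_zero_of_notMem_tsupport hx
  have hΔψc : HasCompactSupport (Δ ψ) :=
    HasCompactSupport.intro hψc fun x hx => laplacian_eq_zero_of_notMem_tsupport hx
  have hψ1 : ContDiff ℝ 1 ψ := hψ.of_le (by exact_mod_cast le_top)
  -- slice regularity for `t ∈ (0, S)`
  have hQI : Ioo 0 S ×ˢ (univ : Set (EuclideanSpace ℝ (Fin 3))) ⊆ Ioi 0 ×ˢ univ :=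
    prod_mono (fun t ht => ht.1) Subset.rfl
  have hU1 : ∀ t ∈ Ioo 0 S, ContDiff ℝ 1 (u t) := fun t ht => (hsm t ht).of_le (by exact_mod_cast le_top)
  have hE1 : ∀ t ∈ Ioo 0 S, ContDiff ℝ 1 (E' t) := fun t ht => (hEsm t ht.1).of_le one_le_two
  have hW1 : ∀ t ∈ Ioo 0 S, ContDiff ℝ 1 (fun x => u t x - E' t x) := fun t ht => (hU1 t ht).sub (hE1 t ht)
  have cU : ∀ t ∈ Ioo 0 S, Continuous (u t) := fun t ht => (hU1 t ht).continuous
  have cW : ∀ t ∈ Ioo 0 S, Continuous fun x => u t x - E' t x := fun t ht => (hW1 t ht).continuous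
  have cDU : ∀ t ∈ Ioo 0 S, Continuous fun x => fderiv ℝ (u t) x := fun t ht =>
    (hU1 t ht).continuous_fderiv one_ne_zero
  have cDE : ∀ t ∈ Ioo 0 S, Continuous fun x => fderiv ℝ (E' t) x := fun t ht =>
    (hE1 t ht).continuous_fderiv one_ne_zero
  have cDW : ∀ t ∈ Ioo 0 S, Continuous fun x => fderiv ℝ (fun y => u t y - E' t y) x := fun t ht =>
    (hW1 t ht).continuous_fderiv one_ne_zero
  have hDW : ∀ t ∈ Ioo 0 S, ∀ x, fderiv ℝ (fun y => u t y - E' t y) x = fderiv ℝ (u t) x - fderiv ℝ (E' t) x :=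
    fun t ht x => fderiv_fun_sub (((hU1 t ht).differentiable one_ne_zero) x) (((hE1 t ht).differentiable one_ne_zero) x)
  -- slice integrability of the weighted terms
  have iA : ∀ t ∈ Ioo 0 S, Integrable (fun x => (Δ ψ) x * ‖u t x - E' t x‖ ^ 2) volume := fun t ht =>
    (cΔψ.mul ((cW t ht).norm.pow 2)).integrable_of_hasCompactSupport hΔψc.mul_right
  have iT : ∀ t ∈ Ioo 0 S, Integrable (fun x => ⟪u t x, gradient ψ x⟫ * ‖u t x - E' t x‖ ^ 2) volume :=
    fun t ht => by
    refine (((cU t ht).inner cgψ).mul ((cW t ht).norm.pow 2)).integrable_of_hasCompactSupport ?_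
    exact (HasCompactSupport.intro hgψc fun x hx => by
      rw [image_eq_zero_of_notMem_tsupport hx, inner_zero_right]).mul_right
  have iC : ∀ t ∈ Ioo 0 S, Integrable (fun x =>
      ⟪-(fderiv ℝ (u t) x (u t x)), u t x - E' t x⟫ * ψ x) volume := fun t ht =>
    ((((cDU t ht).clm_apply (cU t ht)).neg.inner (cW t ht)).mul cψ).integrable_of_hasCompactSupport
      hψc.mul_left
  have iE : ∀ t ∈ Ioo 0 S, Integrable (fun x =>
      ψ x * ⟪fderiv ℝ (E' t) x (u t x), u t x - E' t x⟫) volume := fun t ht =>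
    (cψ.mul (((cDE t ht).clm_apply (cU t ht)).inner (cW t ht))).integrable_of_hasCompactSupport
      hψc.mul_right
  have iWt : ∀ t ∈ Ioo 0 S, Integrable (fun x =>
      ψ x * ⟪fderiv ℝ (fun y => u t y - E' t y) x (u t x), u t x - E' t x⟫) volume := fun t ht =>
    (cψ.mul (((cDW t ht).clm_apply (cU t ht)).inner (cW t ht))).integrable_of_hasCompactSupport
      hψc.mul_right
  -- the transport identity on each slice: `2∫ψ⟪DW(u), w⟫ = -∫ (u·∇ψ)|w|²`
  have htr : ∀ t ∈ Ioo 0 S, ∫ x, ψ x * ⟪fderiv ℝ (fun y => u t y - E' t y) x (u t x), u t x - E' t x⟫ =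
      -(2⁻¹ * ∫ x, ⟪u t x, gradient ψ x⟫ * ‖u t x - E' t x‖ ^ 2) := by
    intro t ht
    have h := integral_mul_inner_convect_transport_eq (hU1 t ht) (hdf t ht) (hW1 t ht) hψ1 hψc
    simp only [convect, fderiv_apply_eq_inner_gradient] at h
    exact h
  -- the coupling term rewritten: `2∫FC = ∫FT - 2∫FE`
  have hFC_eq : ∀ t ∈ Ioo 0 S, 2 * ∫ x, ⟪-(fderiv ℝ (u t) x (u t x)), u t x - E' t x⟫ * ψ x =
      (∫ x, ⟪u t x, gradient ψ x⟫ * ‖u t x - E' t x‖ ^ 2) -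
        2 * ∫ x, ψ x * ⟪fderiv ℝ (E' t) x (u t x), u t x - E' t x⟫ := by
    intro t ht
    have hpt : ∀ x, ⟪-(fderiv ℝ (u t) x (u t x)), u t x - E' t x⟫ * ψ x =
        -(ψ x * ⟪fderiv ℝ (fun y => u t y - E' t y) x (u t x), u t x - E' t x⟫) -
          ψ x * ⟪fderiv ℝ (E' t) x (u t x), u t x - E' t x⟫ := by
      intro x
      have e : fderiv ℝ (u t) x (u t x) =
          fderiv ℝ (fun y => u t y - E' t y) x (u t x) + fderiv ℝ (E' t) x (u t x) := by
        rw [hDW t ht x, FunLike.coe_sub, Pi.sub_apply, sub_add_cancel]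
      rw [e, neg_add, inner_add_left, inner_neg_left, inner_neg_left]
      ring
    simp_rw [hpt]
    have iN : Integrable (fun x =>
        -(ψ x * ⟪fderiv ℝ (fun y => u t y - E' t y) x (u t x), u t x - E' t x⟫)) volume := (iWt t ht).neg
    rw [integral_sub iN (iE t ht), integral_neg, htr t ht]
    ring
  have mAT : IntegrableOn (fun t => ∫ x, ((Δ ψ) x + ⟪u t x, gradient ψ x⟫) * ‖u t x - E' t x‖ ^ 2)
      (Ioc t₁ t₂) volume := by
    refine (mA.add mT).congr_fun (fun t ht => ?_) measurableSet_Ioc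
    have ht0 : t ∈ Ioo 0 S := ⟨ht₁.trans ht.1, ht.2.trans_lt ht₂⟩
    simp only [Pi.add_apply]
    rw [← integral_add (iA t ht0) (iT t ht0)]
    exact integral_congr_ae (Eventually.of_forall fun x => by ring)
  refine ⟨mAT, mP, mE, ?_⟩
  -- drop the dissipation
  set Rint : ℝ → ℝ := fun t => ∫ x, ((Δ ψ) x * ‖u t x - E' t x‖ ^ 2 +
      2 * (p t x * ⟪u t x - E' t x, gradient ψ x⟫) +
      2 * (⟪-(fderiv ℝ (u t) x (u t x)), u t x - E' t x⟫ * ψ x)) with hRint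
  set Dint : ℝ → ℝ := fun t => ∫ x, frobeniusNormSq (fderiv ℝ (u t) x - fderiv ℝ (E' t) x) * ψ x
    with hDint
  have hD0 : ∀ t, 0 ≤ Dint t := fun t => integral_nonneg fun x =>
    mul_nonneg (frobeniusNormSq_nonneg _) (hψ0 x)
  have hZi' : IntegrableOn (fun t => Rint t - 2 * Dint t) (Ioc t₁ t₂) volume := hZi.mono_set hsub
  have hRi : IntegrableOn Rint (Ioc t₁ t₂) volume :=
    (hZi'.add (mD.const_mul 2)).congr_fun (fun t _ => by simp only [hRint, hDint, Pi.add_apply]; ring)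
      measurableSet_Ioc
  have hstep1 : ∫ t in Ioc t₁ t₂, (Rint t - 2 * Dint t) ≤ ∫ t in Ioc t₁ t₂, Rint t :=
    setIntegral_mono hZi' hRi fun t => by linarith [hD0 t]
  -- rewrite `Rint` a.e. on `(t₁, t₂]`
  have hstep2 : ∫ t in Ioc t₁ t₂, Rint t = ∫ t in Ioc t₁ t₂,
      ((∫ x, ((Δ ψ) x + ⟪u t x, gradient ψ x⟫) * ‖u t x - E' t x‖ ^ 2) +
        2 * (∫ x, p t x * ⟪u t x - E' t x, gradient ψ x⟫) -
        2 * ∫ x, ψ x * ⟪fderiv ℝ (E' t) x (u t x), u t x - E' t x⟫) := by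
    refine integral_congr_ae ?_
    filter_upwards [aeP, ae_restrict_mem measurableSet_Ioc] with t hPt ht
    have ht0 : t ∈ Ioo 0 S := ⟨ht₁.trans ht.1, ht.2.trans_lt ht₂⟩
    have i1 := iA t ht0
    have i2 : Integrable (fun x => 2 * (p t x * ⟪u t x - E' t x, gradient ψ x⟫)) volume := hPt.const_mul 2
    have i3 : Integrable (fun x => 2 * (⟪-(fderiv ℝ (u t) x (u t x)), u t x - E' t x⟫ * ψ x)) volume :=
      (iC t ht0).const_mul 2
    have i12 : Integrable (fun x => (Δ ψ) x * ‖u t x - E' t x‖ ^ 2 +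
        2 * (p t x * ⟪u t x - E' t x, gradient ψ x⟫)) volume := i1.add i2
    simp only [hRint]
    rw [integral_add i12 i3, integral_add i1 i2, integral_const_mul, integral_const_mul,
      hFC_eq t ht0]
    have e : ∫ x, ((Δ ψ) x + ⟪u t x, gradient ψ x⟫) * ‖u t x - E' t x‖ ^ 2 =
        (∫ x, (Δ ψ) x * ‖u t x - E' t x‖ ^ 2) + ∫ x, ⟪u t x, gradient ψ x⟫ * ‖u t x - E' t x‖ ^ 2 := by
      rw [← integral_add (iA t ht0) (iT t ht0)]
      exact integral_congr_ae (Eventually.of_forall fun x => by ring)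
    rw [e]
    ring
  have hY : (∫ x, ψ x * ‖u t₂ x - E' t₂ x‖ ^ 2) - (∫ x, ψ x * ‖u t₁ x - E' t₁ x‖ ^ 2) =
      ∫ t in Ioc t₁ t₂, (Rint t - 2 * Dint t) := hid
  linarith [hY, hstep1, hstep2]


end Literature.Analysis.FluidPDE

end
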